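import Summits.Langlands.Langlands.Theorems.ReciprocityUpToIrreducibilityR.Negative.DetClassRelabelling
import Summits.Langlands.Statement

/-!
# Reciprocity data are not rigid: the quadratic relabelling of the one-dimensional classes of
`GL₂` (negative lemma for crux `ReciprocityUpToIrreducibilityR`, stmt-Langlands-17925)

Refuter seat `refuter-cdisprove-stmt-Langlands-17925-0` (crux disprover), route
`IrreducibilityBySelfDuality`.  The crux R = `∀ F, Nonempty (ReciprocityData F) ∧ ∀ Rec n, …` differs
from its `∃ Rec` parent (stmt-Langlands-14328) only by quantifying over ALL pinned reciprocity data,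
and the picked line (`Cruxes/ReciprocityUpToIrreducibilityR/PICKED.md`) reduces R to 14328 through
the rigidity stub `stub_recRigidityLAlg` ("two reciprocity data agree on the class of every local
component of an L-algebraic cuspidal `π`").  This file (part 2; part 1 = `DetClassRelabelling`, the relabelling `swap η` of
`Irr(GL_n(F))`) makes the `∀ Rec` exposure kernel-precise:

* `swapDatum` — from ANY `L : LocalLanglandsDatum F` and any quasi-character `η` with `η² = 1`, a
  datum with the SAME threaded facts, Artin datum and `ε`-system whose `rec₂` is precomposed with the
  relabelling `[χ ∘ det] ↦ [(χη) ∘ det]` of the one-dimensional classes of `GL₂(F)`; all six clauses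
  of `IsLocalLanglandsGL` are re-verified (this is the example of the "Uniqueness (why not `∃!`)"
  paragraph of `Literature/NumberTheory/Automorphic/LocalLanglandsGL.lean`, carried out);
* `swapDatum_recGL_two_ne` — for `η ≠ 1` its `rec₂` differs from `L.recGL 2`;
* `signQuasiChar` — the unramified sign character `(-1)^{v(x)}`: every non-archimedean local field
  has a non-trivial quasi-character of order two, so the above is hypothesis-free
  (`exists_localLanglandsDatum_recGL_two_ne`);
* `exists_reciprocityData_recGL_two_ne` — every `𝓡 : ReciprocityData K` has a PINNED sibling
  (same `llc_isCanonical`, `llc_eps_isCanonical` data) with a different `rec₂` at any given place;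
* `RecRigidityAllClasses` = the conclusion of `stub_recRigidityLAlg` for EVERY irreducible smooth
  `πv` (its hypothesis `π.1.HasLocalComponentAt v πv.ρ` deleted) and
  `not_recRigidityAllClasses_of_nonempty` — it is FALSE as soon as one reciprocity datum exists
  (which R itself asserts): the hypothesis `HasLocalComponentAt` (⇒ `πv` generic, in tree:
  `CuspidalAutomorphicRepData.exists_isGeneric_of_hasLocalComponentAt`) is load-bearing.

The relabelling never meets a generic class (`swap_mk_of_isGeneric`), hence never a local component
of a cuspidal `π`: it does NOT refute R or the stub as typed.  No `sorry`; axioms standard.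
-/

noncomputable section

open scoped MatrixGroups WithZero
open Literature.NumberTheory.Automorphic Literature.NumberTheory.GaloisRepresentations
open Literature.NumberTheory.GaloisRepresentations.IsNonarchimedeanLocalField ValuativeRel

namespace Summit.Langlands.Langlands.Theorems.ReciprocityUpToIrreducibilityR.Negative

set_option linter.dupNamespace false

/-! ### A quasi-character of order two: the unramified sign character -/

section SignChar

variable (F : Type) [Field F] [ValuativeRel F] [TopologicalSpace F] [IsNonarchimedeanLocalField F]

/-- The sign `(-1)^{ord γ}` of an element of the value group (junk `1` at `γ = 0`). [folklore] -/
def valSign (γ : ValueGroupWithZero F) : ℂˣ :=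
  (-1 : ℂˣ) ^ WithZero.log (_root_.IsNonarchimedeanLocalField.valueGroupWithZeroIsoInt F γ)

/-- **The unramified sign character** `x ↦ (-1)^{v(x)}` of `Fˣ`: a quasi-character of order two,
non-trivial (it is `-1` on elements of odd valuation). [folklore] -/
def signQuasiChar : QuasiChar F where
  toFun x := valSign F (valuation F (x : F))
  map_one' := by simp [valSign]
  map_mul' x y := by
    simp only [valSign, Units.val_mul, map_mul]
    rw [WithZero.log_mul, zpow_add]
    · simp
    · simp
  continuous_toFun :=
    ((isLocallyConstant_valuation_units (F := F)).comp (valSign F)).continuous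

/-- Unfolding lemma for `signQuasiChar`. [folklore] -/
theorem signQuasiChar_apply (x : Fˣ) :
    signQuasiChar F x = (-1 : ℂˣ) ^ WithZero.log
      (_root_.IsNonarchimedeanLocalField.valueGroupWithZeroIsoInt F (valuation F (x : F))) := rfl

/-- The sign character has order dividing two. [folklore] -/
theorem signQuasiChar_mul_self (x : Fˣ) : signQuasiChar F x * signQuasiChar F x = 1 := by
  rw [signQuasiChar_apply, ← mul_zpow]
  have : (-1 : ℂˣ) * -1 = 1 := by ext; simp
  rw [this, one_zpow]

/-- The sign character is `-1 ≠ 1` on an element of valuation one. [folklore] -/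
theorem exists_signQuasiChar_ne_one : ∃ x : Fˣ, signQuasiChar F x ≠ 1 := by
  set e := _root_.IsNonarchimedeanLocalField.valueGroupWithZeroIsoInt F
  obtain ⟨x, hx⟩ := ValuativeRel.valuation_surjective (e.symm (WithZero.exp (1 : ℤ)))
  have hx0 : x ≠ 0 := by
    intro h
    rw [h, map_zero] at hx
    have h1 : e (e.symm (WithZero.exp (1 : ℤ))) = e 0 := by rw [← hx]
    rw [e.apply_symm_apply, map_zero] at h1
    exact WithZero.exp_ne_zero h1
  refine ⟨Units.mk0 x hx0, ?_⟩
  rw [signQuasiChar_apply, Units.val_mk0, hx]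
  change (-1 : ℂˣ) ^ WithZero.log (e (e.symm (WithZero.exp (1 : ℤ)))) ≠ 1
  rw [e.apply_symm_apply, WithZero.log_exp, zpow_one]
  intro h
  have := congrArg (fun u : ℂˣ => (u : ℂ)) h
  norm_num at this

/-- **Every non-archimedean local field has a quasi-character of order two which is not trivial.**
[folklore] -/
theorem exists_quasiChar_mul_self_eq_one_ne_one :
    ∃ η : QuasiChar F, (∀ x, η x * η x = 1) ∧ ∃ x, η x ≠ 1 :=
  ⟨signQuasiChar F, signQuasiChar_mul_self F, exists_signQuasiChar_ne_one F⟩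

end SignChar

/-! ### The sibling datum and the non-uniqueness theorems -/

section Datum

variable {F : Type} [Field F] [ValuativeRel F] [TopologicalSpace F] [IsNonarchimedeanLocalField F]

omit [ValuativeRel F] [IsNonarchimedeanLocalField F] in
/-- A continuous non-trivial additive character takes a value `≠ 1`. [folklore] -/
theorem exists_apply_ne_one_of_isContinuousNontrivial {ψ : AddChar F Circle}
    (h : ψ.IsContinuousNontrivial) : ∃ x, ψ x ≠ 1 :=
  AddChar.ne_zero_iff.1 h.2

omit [ValuativeRel F] [TopologicalSpace F] [IsNonarchimedeanLocalField F] in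
/-- … and so does its inverse. [folklore] -/
theorem exists_inv_apply_ne_one {ψ : AddChar F Circle} (h : ∃ x, ψ x ≠ 1) : ∃ x, ψ⁻¹ x ≠ 1 :=
  h.imp fun x hx => by rwa [AddChar.inv_apply', Ne, inv_eq_one]

/-- **The sibling datum.** From a local Langlands datum `L` and a quasi-character `η` with
`η² = 1`, the datum with the SAME threaded facts, Artin datum and `ε`-system whose `rec₂` is
precomposed with the relabelling `[χ ∘ det] ↦ [(χη) ∘ det]` of the one-dimensional classes of
`GL₂(F)` (all other classes and ranks untouched).  All six clauses of `IsLocalLanglandsGL` are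
re-verified: (i) the relabelling is an involution; (ii) rank `1` is untouched; (iii-L/ε) only
generic classes are constrained and those are fixed; (iv) the relabelling commutes with twists;
(v) central characters agree because `η(a²) = 1`.  This is the example of the "Uniqueness (why not
`∃!`)" paragraph of `LocalLanglandsGL`, carried out. [folklore] -/
def swapDatum (L : LocalLanglandsDatum F) (η : QuasiChar F) (hη2 : ∀ x, η x * η x = 1) :
    LocalLanglandsDatum F where
  hmul := L.hmul
  huniq := L.huniq
  hn := L.hn
  hex := L.hex
  hns := L.hns
  hqc := L.hqc
  artin := L.artin
  eps := L.eps
  eps_artin := L.eps_artin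
  recGL n c := L.recGL n (swap η n c)
  isLocalLanglands :=
    { bijective := fun n => (L.isLocalLanglands.bijective n).comp (swap_bijective η hη2 n)
      gl_one := fun χ π h => by
        show ((L.recGL 1 (IrrClass.mk π)).out.1).IsEquivalent _
        exact L.isLocalLanglands.gl_one χ π h
      lFactor_pairs := by
        intro m n hm hmn π π' ψ hψ hg hg' _ _ ν _ _ _ P
        have hx := exists_apply_ne_one_of_isContinuousNontrivial hψ
        rw [swap_mk_of_isGeneric η π hx hg, swap_mk_of_isGeneric η π' (exists_inv_apply_ne_one hx) hg']
        exact L.isLocalLanglands.lFactor_pairs hm hmn π π' ψ hψ hg hg' ν P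
      epsilon_pairs := by
        intro m n hm hmn π π' ψ hψ hg hg' _ _ μ _ hμ _ _ ν _ _ _ e a
        have hx := exists_apply_ne_one_of_isContinuousNontrivial hψ
        rw [swap_mk_of_isGeneric η π hx hg, swap_mk_of_isGeneric η π' (exists_inv_apply_ne_one hx) hg']
        exact L.isLocalLanglands.epsilon_pairs hm hmn π π' ψ hψ hg hg' μ hμ ν e a
      twist := by
        intro n χ' hχ' π
        rw [swap_twist]
        obtain ⟨π₁, hπ₁⟩ := IrrClass.mk_surjective (swap η n (IrrClass.mk π))
        rw [← hπ₁, IrrClass.twist_mk]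
        exact L.isLocalLanglands.twist n χ' hχ' π₁
      centralChar := by
        intro n π w c hc
        rcases eq_or_ne n 2 with rfl | hn
        · by_cases hd : ∃ χ : QuasiChar F, ActsByDet π χ
          · obtain ⟨χ, hχ⟩ := hd
            rw [swap_two, swapClass_mk_of_actsByDet η hχ]
            refine L.isLocalLanglands.centralChar 2 _ w c (LinearMap.ext fun v => ?_)
            have key : ((charDet 2 η (Matrix.GeneralLinearGroup.scalar (Fin 2) (L.artin.artin w)) :
                ℂˣ) : ℂ) = 1 := by
              rw [charDet_apply, Matrix.GeneralLinearGroup.det_scalar, Fintype.card_fin, pow_two,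
                map_mul, hη2, Units.val_one]
            change ((charDet 2 η (Matrix.GeneralLinearGroup.scalar (Fin 2) (L.artin.artin w)) :
                ℂˣ) : ℂ) • π.ρ (Matrix.GeneralLinearGroup.scalar (Fin 2) (L.artin.artin w)) v =
              (c • (LinearMap.id : π.V →ₗ[ℂ] π.V)) v
            rw [key, one_smul, ← hc]
          · rw [swap_two, swapClass_of_not η (c := IrrClass.mk π) hd]
            exact L.isLocalLanglands.centralChar 2 π w c hc
        · rw [swap_of_ne_two η hn, id]
          exact L.isLocalLanglands.centralChar n π w c hc }

variable (L : LocalLanglandsDatum F) (η : QuasiChar F) (hη2 : ∀ x, η x * η x = 1)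

/-- The sibling datum has the same Artin datum … -/
theorem swapDatum_artin : (swapDatum L η hη2).artin = L.artin := rfl

/-- … the same `ε`-system … -/
theorem swapDatum_eps : (swapDatum L η hη2).eps = L.eps := rfl

/-- … and the same `rec_n` in every rank `n ≠ 2`. [folklore] -/
theorem swapDatum_recGL_of_ne_two {n : ℕ} (hn : n ≠ 2) : (swapDatum L η hη2).recGL n = L.recGL n := by
  funext c
  show L.recGL n (swap η n c) = _
  rw [swap_of_ne_two η hn, id]

/-- `diag(x, 1) ∈ GL₂(F)`. [folklore] -/
def diagUnit (x : Fˣ) : GL (Fin 2) F :=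
  Matrix.GeneralLinearGroup.mkOfDetNeZero !![(x : F), 0; 0, 1] (by simp [Matrix.det_fin_two_of])

omit [ValuativeRel F] [TopologicalSpace F] [IsNonarchimedeanLocalField F] in
/-- `det diag(x, 1) = x`. [folklore] -/
theorem det_diagUnit (x : Fˣ) : Matrix.GeneralLinearGroup.det (diagUnit x) = x := by
  ext
  rw [Matrix.GeneralLinearGroup.val_det_apply]
  change Matrix.det !![(x : F), 0; 0, 1] = x
  rw [Matrix.det_fin_two_of]
  ring

/-- **Non-uniqueness of local Langlands data, even pinned** (the `∀ Rec` exposure of the crux made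
precise): for `η² = 1`, `η ≠ 1`, the sibling datum has a different `rec₂` — it moves the class of
the trivial representation of `GL₂(F)` to the class of `η ∘ det`. [folklore] -/
theorem swapDatum_recGL_two_ne (hη1 : ∃ x, η x ≠ 1) : (swapDatum L η hη2).recGL 2 ≠ L.recGL 2 := by
  intro h
  have h1 : L.recGL 2 (swap η 2 (IrrClass.mk (detCharIrrep 2 (1 : QuasiChar F)))) =
      L.recGL 2 (IrrClass.mk (detCharIrrep 2 (1 : QuasiChar F))) := congrFun h _
  rw [swap_two, swapClass_mk_of_actsByDet η (actsByDet_detCharIrrep 2 1)] at h1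
  obtain ⟨e⟩ := (IrrClass.mk_eq_mk_iff _ _).1 ((L.recGL_bijective 2).1 h1)
  have hA : ActsByDet (detCharIrrep 2 (1 : QuasiChar F)) (1 * η) :=
    ((actsByDet_detCharIrrep 2 (1 : QuasiChar F)).twist η _).transport e
  obtain ⟨x, hx⟩ := hη1
  apply hx
  have h2 : (((1 * η) (Matrix.GeneralLinearGroup.det (diagUnit x)) : ℂˣ) : ℂ) * (1 : ℂ) =
      (((1 : QuasiChar F) (Matrix.GeneralLinearGroup.det (diagUnit x)) : ℂˣ) : ℂ) * (1 : ℂ) :=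
    (hA (diagUnit x) (1 : ℂ)).symm
  have h4 : ∀ y : Fˣ, (1 : QuasiChar F) y = 1 := fun _ => rfl
  rw [mul_one, mul_one, quasiChar_mul_apply, h4, one_mul, det_diagUnit, Units.val_one] at h2
  exact Units.val_eq_one.1 h2

include hη2 in
/-- Symmetric packaging: every local Langlands datum has a sibling with the same normalising pair
`(artin, eps)` and a different `rec₂`, as soon as `Fˣ` has a quasi-character of order two. -/
theorem exists_localLanglandsDatum_recGL_two_ne (hη1 : ∃ x, η x ≠ 1) :
    ∃ L' : LocalLanglandsDatum F, L'.artin = L.artin ∧ L'.eps = L.eps ∧ L'.recGL 2 ≠ L.recGL 2 :=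
  ⟨swapDatum L η hη2, rfl, rfl, swapDatum_recGL_two_ne L η hη2 hη1⟩

/-- **Local Langlands data are never unique as typed**: every `L : LocalLanglandsDatum F` has a
sibling with the same normalising pair `(artin, eps)` — hence passing the same canonical pins — and
a different `rec₂` (take `η` = the unramified sign character). [folklore] -/
theorem exists_localLanglandsDatum_recGL_two_ne' (L : LocalLanglandsDatum F) :
    ∃ L' : LocalLanglandsDatum F, L'.artin = L.artin ∧ L'.eps = L.eps ∧ L'.recGL 2 ≠ L.recGL 2 :=
  ⟨swapDatum L (signQuasiChar F) (signQuasiChar_mul_self F), rfl, rfl,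
    swapDatum_recGL_two_ne L _ _ (exists_signQuasiChar_ne_one F)⟩

end Datum

/-! ### Global reading: `ReciprocityData` is not rigid on all classes -/

section Global

open NumberField IsDedekindDomain

/-- **Every reciprocity datum has a pinned sibling with a different `rec₂` at `v`** (given a
quasi-character of order two of `K_vˣ`): the pins `llc_isCanonical` / `llc_eps_isCanonical` of
`ReciprocityData` see only the Artin data, which the sibling shares.  Hence "two reciprocity data
agree on EVERY class" — the conclusion of the line's `stub_recRigidityLAlg` with its hypothesis
`HasLocalComponentAt` dropped — is false; the crux quantifies `∀ Rec` over genuinely distinct data.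
[folklore] -/
theorem exists_reciprocityData_recGL_two_ne {K : Type} [Field K] [NumberField K]
    (𝓡 : ReciprocityData K) (v : HeightOneSpectrum (𝓞 K)) (η : QuasiChar (v.adicCompletion K))
    (hη2 : ∀ x, η x * η x = 1) (hη1 : ∃ x, η x ≠ 1) :
    ∃ 𝓡' : ReciprocityData K, (𝓡'.llc v).recGL 2 ≠ (𝓡.llc v).recGL 2 ∧
      (∀ w, (𝓡'.llc w).artin = (𝓡.llc w).artin ∧ (𝓡'.llc w).eps = (𝓡.llc w).eps) ∧
      ∀ w n, n ≠ 2 → (𝓡'.llc w).recGL n = (𝓡.llc w).recGL n := by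
  classical
  let ηf : ∀ w : HeightOneSpectrum (𝓞 K), QuasiChar (w.adicCompletion K) :=
    Function.update (fun w => 1) v η
  have hv : ηf v = η := by simp [ηf]
  have hηf : ∀ w x, ηf w x * ηf w x = 1 := by
    intro w x
    rcases eq_or_ne w v with rfl | hw
    · rw [hv]; exact hη2 x
    · have : ηf w = 1 := by simp [ηf, hw]
      rw [this]
      show (1 : ℂˣ) * 1 = 1
      exact one_mul 1
  refine ⟨⟨fun w => swapDatum (𝓡.llc w) (ηf w) (hηf w), fun w => 𝓡.llc_isCanonical w,
    fun w => 𝓡.llc_eps_isCanonical w⟩, ?_, fun w => ⟨rfl, rfl⟩,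
    fun w n hn => swapDatum_recGL_of_ne_two _ _ (hηf w) hn⟩
  have h1 : ∃ x, ηf v x ≠ 1 := by rw [hv]; exact hη1
  exact swapDatum_recGL_two_ne _ _ (hηf v) h1

/-- Hypothesis-free form: every reciprocity datum has, at every finite place, a pinned sibling with
a different `rec₂` there and the same `rec_n` everywhere else (`n ≠ 2`). [folklore] -/
theorem exists_reciprocityData_recGL_two_ne' {K : Type} [Field K] [NumberField K]
    (𝓡 : ReciprocityData K) (v : HeightOneSpectrum (𝓞 K)) :
    ∃ 𝓡' : ReciprocityData K, (𝓡'.llc v).recGL 2 ≠ (𝓡.llc v).recGL 2 ∧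
      (∀ w, (𝓡'.llc w).artin = (𝓡.llc w).artin ∧ (𝓡'.llc w).eps = (𝓡.llc w).eps) ∧
      ∀ w n, n ≠ 2 → (𝓡'.llc w).recGL n = (𝓡.llc w).recGL n :=
  exists_reciprocityData_recGL_two_ne 𝓡 v (signQuasiChar _) (signQuasiChar_mul_self _)
    (exists_signQuasiChar_ne_one _)

/-- Every number field has a finite place (`𝓞 K` is not a field). [folklore] -/
theorem nonempty_heightOneSpectrum (K : Type) [Field K] [NumberField K] :
    Nonempty (HeightOneSpectrum (𝓞 K)) := by
  obtain ⟨M, hM⟩ := Ideal.exists_maximal (𝓞 K)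
  exact ⟨⟨M, hM.isPrime, Ring.ne_bot_of_isMaximal_of_not_isField hM (RingOfIntegers.not_isField K)⟩⟩

/-- **The natural strengthening of the line's rigidity stub** — `stub_recRigidityLAlg` of
`Cruxes/ReciprocityUpToIrreducibilityR` (lead prover-line-stmt-Langlands-17925-0) with its hypothesis
`π.1.HasLocalComponentAt v πv.ρ` (and the then idle `π`, `hcpt`, `IsLAlgebraic` binders) DELETED:
"any two reciprocity data agree on EVERY irreducible smooth class at every place". -/
def RecRigidityAllClasses : Prop :=
  ∀ (K : Type) [Field K] [NumberField K] (Rec Rec' : ReciprocityData K) (n : ℕ), 0 < n →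
    ∀ (v : HeightOneSpectrum (𝓞 K)) (πv : SmoothIrrep (GL (Fin n) (v.adicCompletion K))),
      (Rec.llc v).recGL n (IrrClass.mk πv) = (Rec'.llc v).recGL n (IrrClass.mk πv)

/-- **`RecRigidityAllClasses` is false as soon as ONE reciprocity datum exists** (for any number
field) — in particular under the crux's own non-vacuity conjunct `Nonempty (ReciprocityData F)`:
the hypothesis `HasLocalComponentAt` of `stub_recRigidityLAlg` is load-bearing ("any proof must use
genericity of local components"). [folklore] -/
theorem not_recRigidityAllClasses_of_nonempty {K : Type} [Field K] [NumberField K]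
    (h : Nonempty (ReciprocityData K)) : ¬ RecRigidityAllClasses := by
  intro hrig
  obtain ⟨𝓡⟩ := h
  obtain ⟨v⟩ := nonempty_heightOneSpectrum K
  obtain ⟨𝓡', hne, -, -⟩ := exists_reciprocityData_recGL_two_ne' 𝓡 v
  refine hne (funext fun c => ?_)
  induction c using IrrClass.ind with
  | h πv => exact (hrig K 𝓡 𝓡' 2 two_pos v πv).symm

/-- Packaging against the crux's first conjunct: `(∀ F, Nonempty (ReciprocityData F))` (which R
hands back, and which the line's `stub_nonempty_of_inputs` produces) refutes `RecRigidityAllClasses`.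
[folklore] -/
theorem not_recRigidityAllClasses_of_forall_nonempty
    (hN : ∀ (F : Type) [Field F] [NumberField F], Nonempty (ReciprocityData F)) :
    ¬ RecRigidityAllClasses :=
  not_recRigidityAllClasses_of_nonempty (hN ℚ)

end Global

end Summit.Langlands.Langlands.Theorems.ReciprocityUpToIrreducibilityR.Negative

end
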